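import Summits.NavierStokesRegularity.FunctionalMining.NoGo.TopBotEigSplitShareWindow
import Summits.NavierStokesRegularity.FunctionalMining.NoGo.TopBotEigSplitWallReduction
import Summits.NavierStokesRegularity.FunctionalMining.NoGo.TopBotEigSplitWallSides
import HarnessLib

/-!
# K26 — the share window of D-K6 (c) for EVERY real `q ≥ 2` modulo ONE one-variable sign statement:
# (W) `0 ≤ T` on `(1/3, 2/3)` at `c_axi(q)` ⟺ `0 ≤ ρ_q` there (a fortiori: `ρ_q` concave on `[1/3, 2/3]`) ⟹ `{c | TopBotEigSplitting q c} = Iic (c_axi q)`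

search for candidate a priori estimates; no regularity claim.

Assembly only (a few lines each), over the staged K20b `NoGo.TopBotEigSplitShareWindow` (window modulo (N⁺)(D)(W):
K16 necessity + K19 sufficiency + K20a downward closure), K24 `NoGo.TopBotEigSplitWallReduction` (`T = q²(u(1−u))^{q−2}ρ`,
wall zeros of `ρ` at `c_axi(q)`, (W) from `0 ≤ ρ` / from the concavity of `ρ`) and K25 `NoGo.TopBotEigSplitWallSides` ((N⁺) and
(D) at `c_axi(q)` for every real `q ≥ 2`). Here `ρ_q = wallRho q (cAxi q)` (K24 §2).

§1 For every real `q ≥ 2`, **modulo (W) alone** (`0 ≤ lineT q (c_axi q) u` on `(1/3, 2/3)` — K25 discharges K19's two side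
conditions (N⁺), (D) once and for all): **`topBotEigSplitting_cAxi_of_lineT_nonneg`** (the sharp share `c_axi(q)` is ATTAINED),
`topBotEigSplitting_isGreatest_of_lineT_nonneg`, **`topBotEigSplitting_window_of_lineT_nonneg`** (`{c | TopBotEigSplitting q c} =
Iic (c_axi q)`), `topBotEigSplitting_iff_of_lineT_nonneg`, `sSup_topBotEigSplitting_of_lineT_nonneg`, `topBotEigSplitting_window_of_lineT_nonneg_Icc`
— so a per-`q` brick now needs ONLY its interior sign certificate for `T`;
§2 the same five modulo `0 ≤ ρ_q` on `(1/3, 2/3)` (`…_of_wallRho_nonneg`; K24 `lineT_nonneg_iff_wallRho_nonneg`);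
§3 the same five modulo the concavity hypothesis (W⋆) `ConcaveOn ℝ [1/3, 2/3] ρ_q` (`…_of_wallRhoConcave`; K24 wall zeros);
§4 consistency at `q = 4`: `0 ≤ ρ₄` on `(1/3, 2/3)` from K24's `wallBr_four` (`ρ₄ = (5/9)(9p − 2)(2/3 − p)/p²`, `p = u(1−u) ∈
(2/9, 1/4]`), so §2 re-derives the `q = 4` window `Iic (2/9)` of K17/K20b through the general route.

READING. For every real `q ≥ 2` the finite-dimensional debt of door (c) — the exact share window — is now ONE explicit
inequality in ONE real variable: `wallRho q (c_axi q) u ≥ 0` for `u ∈ (1/3, 2/3)` (K24 gives its closed form; it vanishes at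
both walls; it is certified numerically, together with the concavity of `ρ_q`, for `2 ≤ q ≤ 100` — evidence
`sieveld/wall/general/`, readings not verdicts; it is PROVED in the kernel only at `q ∈ {2, 3, 4, 6, 8}` via the bricks).
NOT claimed: `0 ≤ ρ_q` or (W⋆) for any new `q`; nothing on `heatDissipation`; verdict of record unchanged.
search for candidate a priori estimates; no regularity claim.
v2 = v1 abf01a4cf5ed4095 with `topBotEigSplitting_four_window_general` DEMOTED to an `example` (its type is verbatim K20b's
`topBotEigSplitting_four_window_cAxi` (`NoGo.TopBotEigSplitShareWindow`, imported here, lands first) — census-1 (cc.265) T2);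
every other byte of the Lean text is unchanged.
FILING (prove seat g28, REQUEST #42): declarations byte-identical to the no-go seat's staged `TopBotEigSplitWallGeneral.STAGING.lean` ab0fee8e62517d68; this line is the only addition.
-/

open Set

noncomputable section

namespace Summit.NavierStokesRegularity.FunctionalMining

namespace TopEig

/-! ## 1. The window for every real `q ≥ 2` modulo (W) alone -/

section lineT

variable {q : ℝ} (hq : 2 ≤ q) (hT : ∀ ⦃u : ℝ⦄, 1 / 3 < u → u < 2 / 3 → 0 ≤ lineT q (cAxi q) u)
include hq hT

/-- **The sharp share is attained**, every real `q ≥ 2`, modulo (W) alone: `TopBotEigSplitting q (c_axi q)`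
(K19 `topBotEigSplitting_of_line` with K25's `lineN_cAxi_pos`, `lineD_cAxi`). [ours] -/
theorem topBotEigSplitting_cAxi_of_lineT_nonneg : TopBotEigSplitting q (cAxi q) :=
  topBotEigSplitting_of_line (by linarith) (cAxi_pos (by linarith)).le (fun _ h1 h2 => lineN_cAxi_pos hq h1 h2)
    (fun _ h1 h2 => lineD_cAxi hq h1 h2) hT

/-- `c_axi(q)` is the GREATEST splitting share, every real `q ≥ 2`, modulo (W) alone. [ours] -/
theorem topBotEigSplitting_isGreatest_of_lineT_nonneg : IsGreatest {c : ℝ | TopBotEigSplitting q c} (cAxi q) :=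
  topBotEigSplitting_isGreatest_of_line (by linarith) (fun _ h1 h2 => lineN_cAxi_pos hq h1 h2)
    (fun _ h1 h2 => lineD_cAxi hq h1 h2) hT

/-- **The share window is `Iic (c_axi q)`**, every real `q ≥ 2`, modulo (W) alone. [ours] -/
theorem topBotEigSplitting_window_of_lineT_nonneg : {c : ℝ | TopBotEigSplitting q c} = Iic (cAxi q) :=
  topBotEigSplitting_window_of_line (by linarith) (fun _ h1 h2 => lineN_cAxi_pos hq h1 h2)
    (fun _ h1 h2 => lineD_cAxi hq h1 h2) hT

/-- Pointwise form, every real `q ≥ 2`, modulo (W) alone: `TopBotEigSplitting q c ↔ c ≤ c_axi q`. [ours, bookkeeping] -/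
theorem topBotEigSplitting_iff_of_lineT_nonneg (c : ℝ) : TopBotEigSplitting q c ↔ c ≤ cAxi q :=
  topBotEigSplitting_iff_le_cAxi_of_line (by linarith) (fun _ h1 h2 => lineN_cAxi_pos hq h1 h2)
    (fun _ h1 h2 => lineD_cAxi hq h1 h2) hT c

/-- Supremum form, every real `q ≥ 2`, modulo (W) alone: `sSup {c | TopBotEigSplitting q c} = c_axi q`. [ours, bookkeeping] -/
theorem sSup_topBotEigSplitting_of_lineT_nonneg : sSup {c : ℝ | TopBotEigSplitting q c} = cAxi q :=
  sSup_topBotEigSplitting_of_line (by linarith) (fun _ h1 h2 => lineN_cAxi_pos hq h1 h2)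
    (fun _ h1 h2 => lineD_cAxi hq h1 h2) hT

end lineT

/-- Closed-interval variant of the window theorem (the per-`q` bricks state (W) on `[1/3, 2/3]`). [ours, bookkeeping] -/
theorem topBotEigSplitting_window_of_lineT_nonneg_Icc {q : ℝ} (hq : 2 ≤ q)
    (hT : ∀ ⦃u : ℝ⦄, 1 / 3 ≤ u → u ≤ 2 / 3 → 0 ≤ lineT q (cAxi q) u) : {c : ℝ | TopBotEigSplitting q c} = Iic (cAxi q) :=
  topBotEigSplitting_window_of_lineT_nonneg hq fun _ h1 h2 => hT h1.le h2.le

/-! ## 2. The window for every real `q ≥ 2` modulo `0 ≤ ρ_q` on `(1/3, 2/3)` -/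

section nonneg

variable {q : ℝ} (hq : 2 ≤ q) (hρ : ∀ ⦃u : ℝ⦄, 1 / 3 < u → u < 2 / 3 → 0 ≤ wallRho q (cAxi q) u)
include hq hρ

/-- (W) at `c_axi(q)` from `0 ≤ ρ_q` on `(1/3, 2/3)` (K24 `lineT_nonneg_iff_wallRho_nonneg`). [ours, bookkeeping] -/
theorem lineT_cAxi_nonneg_of_wallRho_nonneg ⦃u : ℝ⦄ (hu1 : 1 / 3 < u) (hu2 : u < 2 / 3) :
    0 ≤ lineT q (cAxi q) u :=
  (lineT_nonneg_iff_wallRho_nonneg (by linarith : q ≠ 0) (by linarith) (by linarith)).2 (hρ hu1 hu2)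

/-- **The sharp share is attained**, every real `q ≥ 2`, modulo `0 ≤ ρ_q` on `(1/3, 2/3)`:
`TopBotEigSplitting q (c_axi q)`. [ours] -/
theorem topBotEigSplitting_cAxi_of_wallRho_nonneg : TopBotEigSplitting q (cAxi q) :=
  topBotEigSplitting_cAxi_of_lineT_nonneg hq (lineT_cAxi_nonneg_of_wallRho_nonneg hq hρ)

/-- `c_axi(q)` is the GREATEST splitting share, every real `q ≥ 2`, modulo `0 ≤ ρ_q` on `(1/3, 2/3)`. [ours] -/
theorem topBotEigSplitting_isGreatest_of_wallRho_nonneg : IsGreatest {c : ℝ | TopBotEigSplitting q c} (cAxi q) :=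
  topBotEigSplitting_isGreatest_of_lineT_nonneg hq (lineT_cAxi_nonneg_of_wallRho_nonneg hq hρ)

/-- **The share window is `Iic (c_axi q)`**, every real `q ≥ 2`, modulo `0 ≤ ρ_q` on `(1/3, 2/3)`. [ours] -/
theorem topBotEigSplitting_window_of_wallRho_nonneg : {c : ℝ | TopBotEigSplitting q c} = Iic (cAxi q) :=
  topBotEigSplitting_window_of_lineT_nonneg hq (lineT_cAxi_nonneg_of_wallRho_nonneg hq hρ)

/-- Pointwise form, every real `q ≥ 2`, modulo `0 ≤ ρ_q`: `TopBotEigSplitting q c ↔ c ≤ c_axi q`. [ours, bookkeeping] -/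
theorem topBotEigSplitting_iff_of_wallRho_nonneg (c : ℝ) : TopBotEigSplitting q c ↔ c ≤ cAxi q :=
  topBotEigSplitting_iff_of_lineT_nonneg hq (lineT_cAxi_nonneg_of_wallRho_nonneg hq hρ) c

/-- Supremum form, every real `q ≥ 2`, modulo `0 ≤ ρ_q`: `sSup {c | TopBotEigSplitting q c} = c_axi q`.
[ours, bookkeeping] -/
theorem sSup_topBotEigSplitting_of_wallRho_nonneg : sSup {c : ℝ | TopBotEigSplitting q c} = cAxi q :=
  sSup_topBotEigSplitting_of_lineT_nonneg hq (lineT_cAxi_nonneg_of_wallRho_nonneg hq hρ)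

end nonneg

/-! ## 3. The window for every real `q ≥ 2` modulo the concavity (W⋆) of `ρ_q` on `[1/3, 2/3]` -/

section concave

variable {q : ℝ} (hq : 2 ≤ q) (hW : ConcaveOn ℝ (Icc (1 / 3 : ℝ) (2 / 3)) (wallRho q (cAxi q)))
include hq hW

/-- (W⋆) gives `0 ≤ ρ_q` on `(1/3, 2/3)` (K24: concave with vanishing wall values). [ours, bookkeeping] -/
theorem wallRho_cAxi_nonneg_of_wallRhoConcave ⦃u : ℝ⦄ (hu1 : 1 / 3 < u) (hu2 : u < 2 / 3) :
    0 ≤ wallRho q (cAxi q) u :=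
  nonneg_of_concaveOn_walls hW (wallRho_one_third_cAxi (by linarith)).ge (wallRho_two_thirds_cAxi (by linarith)).ge
    hu1.le hu2.le

/-- **The sharp share is attained**, every real `q ≥ 2`, modulo (W⋆). [ours] -/
theorem topBotEigSplitting_cAxi_of_wallRhoConcave : TopBotEigSplitting q (cAxi q) :=
  topBotEigSplitting_cAxi_of_wallRho_nonneg hq (wallRho_cAxi_nonneg_of_wallRhoConcave hq hW)

/-- `c_axi(q)` is the greatest splitting share, every real `q ≥ 2`, modulo (W⋆). [ours] -/
theorem topBotEigSplitting_isGreatest_of_wallRhoConcave : IsGreatest {c : ℝ | TopBotEigSplitting q c} (cAxi q) :=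
  topBotEigSplitting_isGreatest_of_wallRho_nonneg hq (wallRho_cAxi_nonneg_of_wallRhoConcave hq hW)

/-- **The share window is `Iic (c_axi q)`**, every real `q ≥ 2`, modulo (W⋆). [ours] -/
theorem topBotEigSplitting_window_of_wallRhoConcave : {c : ℝ | TopBotEigSplitting q c} = Iic (cAxi q) :=
  topBotEigSplitting_window_of_wallRho_nonneg hq (wallRho_cAxi_nonneg_of_wallRhoConcave hq hW)

/-- Pointwise form modulo (W⋆). [ours, bookkeeping] -/
theorem topBotEigSplitting_iff_of_wallRhoConcave (c : ℝ) : TopBotEigSplitting q c ↔ c ≤ cAxi q :=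
  topBotEigSplitting_iff_of_wallRho_nonneg hq (wallRho_cAxi_nonneg_of_wallRhoConcave hq hW) c

/-- Supremum form modulo (W⋆). [ours, bookkeeping] -/
theorem sSup_topBotEigSplitting_of_wallRhoConcave : sSup {c : ℝ | TopBotEigSplitting q c} = cAxi q :=
  sSup_topBotEigSplitting_of_wallRho_nonneg hq (wallRho_cAxi_nonneg_of_wallRhoConcave hq hW)

end concave

/-! ## 4. Consistency at `q = 4`: `0 ≤ ρ₄` on `(1/3, 2/3)`, hence the `q = 4` window through the general route -/

/-- `0 ≤ ρ₄ = wallRho 4 (c_axi 4)` on `(1/3, 2/3)` (`c_axi 4 = 2/9`, K24 `wallBr_four`). [ours, bookkeeping] -/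
theorem wallRho_four_nonneg ⦃u : ℝ⦄ (hu1 : 1 / 3 < u) (hu2 : u < 2 / 3) : 0 ≤ wallRho 4 (cAxi 4) u := by
  rw [cAxi_four, wallRho, wallBr_four]
  have hp1 : 0 < 9 * (u * (1 - u)) - 2 := by nlinarith
  have hp2 : 0 < 2 / 3 - u * (1 - u) := by nlinarith [sq_nonneg (u - 1 / 2)]
  exact div_nonneg (by positivity) (mul_rpow_line_pos (by linarith) (by linarith) 4).le

/- The `q = 4` window `Iic (c_axi 4)` re-derived through the general-`q` route of §2 — a kernel-checked `example` (v2):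
the statement is K20b's `topBotEigSplitting_four_window_cAxi` by name. [ours, bookkeeping] -/
example : {c : ℝ | TopBotEigSplitting 4 c} = Iic (cAxi 4) :=
  topBotEigSplitting_window_of_wallRho_nonneg (by norm_num) wallRho_four_nonneg

end TopEig

end Summit.NavierStokesRegularity.FunctionalMining
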